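import Summits.CriticalPhenomena.PercolationContinuityZ3.Theorems.PercNonProliferationSubpolynomialBlockingStubCruxIffSeedSubpoly
import HarnessLib

/-!
# Crux `PercNonProliferation.SubpolynomialBlocking` (stmt-CriticalPhenomena-4446), line `slab-ladder-two-curtains` — stub `stub_cruxIffCurtainSubpoly`

Helper file for the crux skeleton `Cruxes/SubpolynomialBlocking/Lines/slab_ladder_two_curtains.lean`
(lead prover-line-stmt-CriticalPhenomena-4446-c2). Proves exactly the registered stub signature
`stub_cruxIffCurtainSubpoly`; lands with `--supports stmt-CriticalPhenomena-4446`.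

## The statement (THE CURTAIN FORM OF THE CRUX)

Write `u_n = P_{p_c}(Λ_n ↮ ∂ⁱⁿΛ_{2n} inside Λ_{2n})` (the crux is `∀ s > 0, ∀ᶠ n, n^{-s} ≤ u_n`) and
`κ_n = P_{p_c}(curtain_n)`, where the CURTAIN is the event that no open path inside `Λ_{2n} = B(2n)`
joins the full-height column `{v ∈ B(2n) : |v₁| ≤ n, |v₂| ≤ n}` to its lateral boundary
`{v ∈ B(2n) : |v₁| = 2n ∨ |v₂| = 2n}` (Newman–Tassion–Wu 2017, Cor. 3.2 (4), read on `ℤ³`). Then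

  `SubpolynomialBlocking ↔ ∀ s > 0, ∀ᶠ n, n^{-s} ≤ κ_n`.

## The argument

* `⇐` (`StubCruxIffCurtainSubpoly.curtain_sq_le_block`): `κ_n² ≤ u_n` for every `p`, `n`. The
  curtain around the `0`-column and its image under the lattice automorphism `σ : x ↦ (x₂, x₁, x₀)`
  (`zdSignedPermIso (swap 0 2) 1`) together block `Λ_n` from `∂ⁱⁿΛ_{2n}` (a site of `∂ⁱⁿΛ_{2n}` has
  some coordinate `= ±2n`, `exists_eq_of_mem_innerBoundary_box`); both are decreasing measurable
  events of the same probability (`StubSixSlab.real_compl_openCrossing_image`, Grimmett 1999 §1.6),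
  so Harris–FKG (`harris_fkg_lower`, Grimmett 1999 Thm. 2.4) gives `κ_n · κ_n ≤ u_n`; then
  `n^{-s} = (n^{-s/2})²` (`StubCruxIffSeedSubpoly.subpoly_of_pow_le`).
* `⇒` (`StubCruxIffCurtainSubpoly.seal_pow_four_le_curtain`): `V_n⁴ ≤ κ_n`, where `V_n` is the
  sealing probability of the face-slab `[n, 2n] × [-2n, 2n]²` across direction `0` (the quantity of
  `stub_sixSlab` / `stub_tiling`). DETERMINISTIC: an open lattice walk inside `B(2n)` from the column
  to a lateral face `{y_i = ±2n}`, `i ∈ {1, 2}`, contains — after its last visit below level `n` of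
  the height `±z_i` — a traverse of the face-slab `{z ∈ B(2n) : n ≤ ±z_i}` from `{±z_i = n}` to
  `{±z_i = 2n}` (`exists_traverse`), which uses a closed edge as soon as that slab (the image of the
  reference slab under the signed permutation `σ_{i,±}`) is sealed (`StubSixSlab.exists_edge_not_mem`).
  MEASURE: Harris–FKG over the four decreasing seals of common probability `V_n`
  (`prob_pow_le_biInter_of_isLowerSet` over `{1, 2} × ℤˣ`), and `real_mono_of_forall_subset_edgeSet`.
  Finally `V_n` is sub-polynomial under the crux: `stub_cruxIffSeedSubpoly 2` (`⇒`, p86229) makes the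
  flat seed sub-polynomial and `stub_tiling 2` (p80188) bounds `V_n ≥ seed^K`.

No definitions; all sets are written literally (the curtain is `(openCrossing ↑B(2n) column lateral)ᶜ`
definitionally, `StubCruxIffCurtainSubpoly.curtain_eq`).
-/

noncomputable section

namespace Summit.CriticalPhenomena.PercolationContinuityZ3.Theorems.SubpolynomialBlocking

open MeasureTheory Filter Topology
open Literature.Probability.Percolation Literature.Probability.LatticeModels
open Literature.Probability.Percolation.DCT16
open Literature.Barriers.CriticalPhenomena
open Summit.CriticalPhenomena.PercolationContinuityZ3.Theorems.SubpolynomialBlocking.Negative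

namespace StubCruxIffCurtainSubpoly

/-! ### The curtain as the complement of an open-crossing event -/

/-- The curtain event of the signature is, definitionally, the complement of the open-crossing
event of `B(2n)` between the column and its lateral boundary. -/
theorem curtain_eq (n : ℕ) :
    {ω : BondConfig (Site 3) |
        ¬ ∃ x ∈ {v : Site 3 | v ∈ box 3 (2 * n) ∧ |v 1| ≤ (n : ℤ) ∧ |v 2| ≤ (n : ℤ)},
          ∃ y ∈ {v : Site 3 | v ∈ box 3 (2 * n) ∧ (|v 1| = 2 * (n : ℤ) ∨ |v 2| = 2 * (n : ℤ))},
            ω ∈ openConnIn (↑(box 3 (2 * n)) : Set (Site 3)) x y} =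
      (openCrossing (↑(box 3 (2 * n)) : Set (Site 3))
        {v : Site 3 | v ∈ box 3 (2 * n) ∧ |v 1| ≤ (n : ℤ) ∧ |v 2| ≤ (n : ℤ)}
        {v : Site 3 | v ∈ box 3 (2 * n) ∧ (|v 1| = 2 * (n : ℤ) ∨ |v 2| = 2 * (n : ℤ))})ᶜ :=
  rfl

/-! ### `⇐`: two curtains make a sphere -/

/-- The inverse of the swap `σ = zdSignedPermIso (swap 0 2) 1` preserves the boxes `B(m)`. -/
theorem swap02_symm_mem_box {m : ℕ} {z : Site 3} (hz : z ∈ box 3 m) :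
    (zdSignedPermIso (Equiv.swap (0 : Fin 3) 2) (fun _ => 1)).symm z ∈ box 3 m := by
  rw [mem_box] at hz ⊢
  intro j
  rw [StubSixSlab.iso_symm_apply]
  simpa using hz (Equiv.swap (0 : Fin 3) 2 j)

/-- Coordinate `1` of `σ⁻¹ z` is `z₁`. -/
theorem swap02_symm_apply_one (z : Site 3) :
    (zdSignedPermIso (Equiv.swap (0 : Fin 3) 2) (fun _ => 1)).symm z 1 = z 1 := by
  have h : Equiv.swap (0 : Fin 3) 2 1 = 1 := Equiv.swap_apply_of_ne_of_ne (by decide) (by decide)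
  rw [StubSixSlab.iso_symm_apply, h]
  simp

/-- Coordinate `2` of `σ⁻¹ z` is `z₀`. -/
theorem swap02_symm_apply_two (z : Site 3) :
    (zdSignedPermIso (Equiv.swap (0 : Fin 3) 2) (fun _ => 1)).symm z 2 = z 0 := by
  rw [StubSixSlab.iso_symm_apply, Equiv.swap_apply_right]
  simp

/-- `σ '' B(m) = B(m)` (`signedPerm_image_box`). -/
theorem swap02_image_box (m : ℕ) :
    (zdSignedPermIso (Equiv.swap (0 : Fin 3) 2) (fun _ => 1)) '' (↑(box 3 m) : Set (Site 3)) =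
      ↑(box 3 m) :=
  signedPerm_image_box _ _ m

/-- **Two curtains make a sphere** (deterministic, every configuration): if `ω` has no open path
inside `B(2n)` from the `0`-column to its lateral boundary, and none from the `σ`-image of the
column to the `σ`-image of the lateral boundary, then `Λ_n ↮ ∂ⁱⁿΛ_{2n}` inside `Λ_{2n}`: an exit
site has a coordinate `y_i = ±2n`; `i ∈ {1,2}` is lateral for the column, `i = 0` for its image. -/
theorem two_curtains {n : ℕ} {ω : BondConfig (Site 3)}
    (h0 : ω ∉ openCrossing (↑(box 3 (2 * n)) : Set (Site 3))
        {v : Site 3 | v ∈ box 3 (2 * n) ∧ |v 1| ≤ (n : ℤ) ∧ |v 2| ≤ (n : ℤ)}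
        {v : Site 3 | v ∈ box 3 (2 * n) ∧ (|v 1| = 2 * (n : ℤ) ∨ |v 2| = 2 * (n : ℤ))})
    (h2 : ω ∉ openCrossing (↑(box 3 (2 * n)) : Set (Site 3))
        ((zdSignedPermIso (Equiv.swap (0 : Fin 3) 2) (fun _ => 1)) ''
          {v : Site 3 | v ∈ box 3 (2 * n) ∧ |v 1| ≤ (n : ℤ) ∧ |v 2| ≤ (n : ℤ)})
        ((zdSignedPermIso (Equiv.swap (0 : Fin 3) 2) (fun _ => 1)) ''
          {v : Site 3 | v ∈ box 3 (2 * n) ∧ (|v 1| = 2 * (n : ℤ) ∨ |v 2| = 2 * (n : ℤ))})) :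
    ω ∈ {ω : BondConfig (Site 3) | ¬ ∃ x ∈ box 3 n,
      ∃ y ∈ innerBoundary (zdGraph 3) (box 3 (2 * n)),
        ω ∈ openConnIn (↑(box 3 (2 * n)) : Set (Site 3)) x y} := by
  rintro ⟨x, hx, y, hy, hxy⟩
  have hyB : y ∈ box 3 (2 * n) := (Finset.mem_filter.1 hy).1
  have hx' := mem_box.1 hx
  have hx2 : x ∈ box 3 (2 * n) := by
    rw [mem_box]
    intro i
    have h := hx' i
    push_cast
    omega
  obtain ⟨i, hi⟩ := exists_eq_of_mem_innerBoundary_box hy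
  have habs : |y i| = 2 * (n : ℤ) := by
    have h2n : (0 : ℤ) ≤ 2 * (n : ℤ) := by positivity
    push_cast at hi
    rcases hi with h | h
    · rw [h]; exact abs_of_nonneg h2n
    · rw [h, abs_neg]; exact abs_of_nonneg h2n
  fin_cases i
  · refine h2 ⟨x, ⟨_, ⟨swap02_symm_mem_box hx2, ?_, ?_⟩, RelIso.apply_symm_apply _ x⟩,
      y, ⟨_, ⟨swap02_symm_mem_box hyB, Or.inr ?_⟩, RelIso.apply_symm_apply _ y⟩, hxy⟩
    · rw [swap02_symm_apply_one]; exact abs_le.2 (hx' 1)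
    · rw [swap02_symm_apply_two]; exact abs_le.2 (hx' 0)
    · rw [swap02_symm_apply_two]; exact habs
  · exact h0 ⟨x, ⟨hx2, abs_le.2 (hx' 1), abs_le.2 (hx' 2)⟩, y, ⟨hyB, Or.inl habs⟩, hxy⟩
  · exact h0 ⟨x, ⟨hx2, abs_le.2 (hx' 1), abs_le.2 (hx' 2)⟩, y, ⟨hyB, Or.inr habs⟩, hxy⟩

/-- **`κ_n² ≤ u_n`** for every `p`, `n`: Harris–FKG (`harris_fkg_lower`, Grimmett 1999 Thm. 2.4)
for the curtain and its `σ`-image — two decreasing measurable events of the same probability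
(`StubSixSlab.real_compl_openCrossing_image`, Grimmett 1999 §1.6) — and `two_curtains`. -/
theorem curtain_sq_le_block (p : unitInterval) (n : ℕ) :
    (bondPercolation (zdGraph 3) p).real
        (openCrossing (↑(box 3 (2 * n)) : Set (Site 3))
          {v : Site 3 | v ∈ box 3 (2 * n) ∧ |v 1| ≤ (n : ℤ) ∧ |v 2| ≤ (n : ℤ)}
          {v : Site 3 | v ∈ box 3 (2 * n) ∧ (|v 1| = 2 * (n : ℤ) ∨ |v 2| = 2 * (n : ℤ))})ᶜ ^ 2 ≤
      (bondPercolation (zdGraph 3) p).real {ω : BondConfig (Site 3) | ¬ ∃ x ∈ box 3 n,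
        ∃ y ∈ innerBoundary (zdGraph 3) (box 3 (2 * n)),
          ω ∈ openConnIn (↑(box 3 (2 * n)) : Set (Site 3)) x y} := by
  have hsymm := StubSixSlab.real_compl_openCrossing_image
    (zdSignedPermIso (Equiv.swap (0 : Fin 3) 2) (fun _ => 1)) p (↑(box 3 (2 * n)) : Set (Site 3))
    {v : Site 3 | v ∈ box 3 (2 * n) ∧ |v 1| ≤ (n : ℤ) ∧ |v 2| ≤ (n : ℤ)}
    {v : Site 3 | v ∈ box 3 (2 * n) ∧ (|v 1| = 2 * (n : ℤ) ∨ |v 2| = 2 * (n : ℤ))}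
  rw [swap02_image_box] at hsymm
  have hH := harris_fkg_lower (zdGraph 3) p
    (isUpperSet_openCrossing (↑(box 3 (2 * n)) : Set (Site 3))
      {v : Site 3 | v ∈ box 3 (2 * n) ∧ |v 1| ≤ (n : ℤ) ∧ |v 2| ≤ (n : ℤ)}
      {v : Site 3 | v ∈ box 3 (2 * n) ∧ (|v 1| = 2 * (n : ℤ) ∨ |v 2| = 2 * (n : ℤ))}).compl
    (isUpperSet_openCrossing (↑(box 3 (2 * n)) : Set (Site 3))
      ((zdSignedPermIso (Equiv.swap (0 : Fin 3) 2) (fun _ => 1)) ''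
        {v : Site 3 | v ∈ box 3 (2 * n) ∧ |v 1| ≤ (n : ℤ) ∧ |v 2| ≤ (n : ℤ)})
      ((zdSignedPermIso (Equiv.swap (0 : Fin 3) 2) (fun _ => 1)) ''
        {v : Site 3 | v ∈ box 3 (2 * n) ∧ (|v 1| = 2 * (n : ℤ) ∨ |v 2| = 2 * (n : ℤ))})).compl
    (measurableSet_openCrossing_of_countable _ _ _).compl
    (measurableSet_openCrossing_of_countable _ _ _).compl
  rw [hsymm] at hH
  rw [sq]
  exact hH.trans (measureReal_mono fun ω hω => two_curtains hω.1 hω.2)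

/-! ### `⇒`: four lateral seals make a curtain -/

/-- **One lateral direction.** If `ω` seals both signed-permutation images `σ_{i,±}` of the
reference slab `[n, 2n] × [-2n, 2n]²` (no open path inside the image from the image of
`{x₀ = n}` to the image of `{x₀ = 2n}`), then every lattice walk inside `B(2n)` from `{|z_i| ≤ n}`
to `{|z_i| = 2n}` has an edge outside `ω`: its final traverse of the face-slab `{n ≤ ±z_i ≤ 2n}`
(`exists_traverse` for the height `±z_i`) would otherwise be an open crossing of that image slab
(`StubSixSlab.exists_edge_not_mem`). -/
theorem exists_edge_not_mem_of_exit {n : ℕ} {ω : BondConfig (Site 3)} (i : Fin 3)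
    (hseal : ∀ ε : ℤˣ, ω ∉ openCrossing
        ((zdSignedPermIso (Equiv.swap (0 : Fin 3) i) (fun _ => ε)) ''
          Set.Icc (![(n : ℤ), -(2 * (n : ℤ)), -(2 * (n : ℤ))] : Site 3)
            ![2 * (n : ℤ), 2 * (n : ℤ), 2 * (n : ℤ)])
        ((zdSignedPermIso (Equiv.swap (0 : Fin 3) i) (fun _ => ε)) ''
          {x | x ∈ Set.Icc (![(n : ℤ), -(2 * (n : ℤ)), -(2 * (n : ℤ))] : Site 3)
            ![2 * (n : ℤ), 2 * (n : ℤ), 2 * (n : ℤ)] ∧ x 0 = (n : ℤ)})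
        ((zdSignedPermIso (Equiv.swap (0 : Fin 3) i) (fun _ => ε)) ''
          {y | y ∈ Set.Icc (![(n : ℤ), -(2 * (n : ℤ)), -(2 * (n : ℤ))] : Site 3)
            ![2 * (n : ℤ), 2 * (n : ℤ), 2 * (n : ℤ)] ∧ y 0 = 2 * (n : ℤ)}))
    {a b : Site 3} (P : (zdGraph 3).Walk a b)
    (hP : ∀ z ∈ P.support, ∀ j, -(2 * (n : ℤ)) ≤ z j ∧ z j ≤ 2 * (n : ℤ))
    (ha : |a i| ≤ (n : ℤ)) (hb : |b i| = 2 * (n : ℤ)) : ∃ e ∈ P.edges, e ∉ ω := by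
  have h2n : (0 : ℤ) ≤ 2 * (n : ℤ) := by positivity
  have ha' := abs_le.1 ha
  rcases (abs_eq h2n).1 hb with hb' | hb'
  · -- exit through `{z_i = 2n}`: traverse of `{n ≤ z_i ≤ 2n}`
    obtain ⟨c, e, W, hc, he, hWs, hWe⟩ := exists_traverse (fun z : Site 3 => z i)
      (apply_le_apply_add_one_of_adj i) P (show (n : ℤ) ≤ 2 * (n : ℤ) by omega)
      ⟨a, P.start_mem_support, ha'.2⟩ hb'.ge
    obtain ⟨x, hx, hxω⟩ := StubSixSlab.exists_edge_not_mem i 1 (hseal 1) W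
      (fun z hz => ⟨hP z (hWs z hz).1, by simpa using (hWs z hz).2.1⟩) (by simpa using hc)
      (by simpa using he)
    exact ⟨x, hWe x hx, hxω⟩
  · -- exit through `{z_i = -2n}`: traverse of `{n ≤ -z_i ≤ 2n}`
    obtain ⟨c, e, W, hc, he, hWs, hWe⟩ := exists_traverse (fun z : Site 3 => -z i)
      (neg_apply_le_neg_apply_add_one_of_adj i) P (show (n : ℤ) ≤ 2 * (n : ℤ) by omega)
      ⟨a, P.start_mem_support, by omega⟩ (by omega)
    obtain ⟨x, hx, hxω⟩ := StubSixSlab.exists_edge_not_mem i (-1) (hseal (-1)) W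
      (fun z hz => ⟨hP z (hWs z hz).1, by
        have h := (hWs z hz).2.1
        simp only [Units.val_neg, Units.val_one] at h ⊢
        omega⟩)
      (by simp only [Units.val_neg, Units.val_one] at hc ⊢; omega)
      (by simp only [Units.val_neg, Units.val_one] at he ⊢; omega)
    exact ⟨x, hWe x hx, hxω⟩

/-- **Four seals make a curtain** (deterministic, lattice configurations `ω ⊆ E(ℤ³)`): if `ω`
seals the four lateral signed-permutation images `σ_{i,ε}`, `i ∈ {1, 2}`, `ε = ±1`, of the
reference slab, then no open path inside `B(2n)` joins the `0`-column to its lateral boundary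
(`exists_walk_of_mem_openConnIn` + `exists_edge_not_mem_of_exit`). -/
theorem mem_curtain_of_seals {n : ℕ} {ω : BondConfig (Site 3)} (hω : ω ⊆ (zdGraph 3).edgeSet)
    (h : ∀ i ∈ ({1, 2} : Finset (Fin 3)), ∀ ε : ℤˣ, ω ∉ openCrossing
        ((zdSignedPermIso (Equiv.swap (0 : Fin 3) i) (fun _ => ε)) ''
          Set.Icc (![(n : ℤ), -(2 * (n : ℤ)), -(2 * (n : ℤ))] : Site 3)
            ![2 * (n : ℤ), 2 * (n : ℤ), 2 * (n : ℤ)])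
        ((zdSignedPermIso (Equiv.swap (0 : Fin 3) i) (fun _ => ε)) ''
          {x | x ∈ Set.Icc (![(n : ℤ), -(2 * (n : ℤ)), -(2 * (n : ℤ))] : Site 3)
            ![2 * (n : ℤ), 2 * (n : ℤ), 2 * (n : ℤ)] ∧ x 0 = (n : ℤ)})
        ((zdSignedPermIso (Equiv.swap (0 : Fin 3) i) (fun _ => ε)) ''
          {y | y ∈ Set.Icc (![(n : ℤ), -(2 * (n : ℤ)), -(2 * (n : ℤ))] : Site 3)
            ![2 * (n : ℤ), 2 * (n : ℤ), 2 * (n : ℤ)] ∧ y 0 = 2 * (n : ℤ)})) :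
    ω ∈ (openCrossing (↑(box 3 (2 * n)) : Set (Site 3))
        {v : Site 3 | v ∈ box 3 (2 * n) ∧ |v 1| ≤ (n : ℤ) ∧ |v 2| ≤ (n : ℤ)}
        {v : Site 3 | v ∈ box 3 (2 * n) ∧ (|v 1| = 2 * (n : ℤ) ∨ |v 2| = 2 * (n : ℤ))})ᶜ := by
  rintro ⟨x, hx, y, hy, hxy⟩
  obtain ⟨P, hPS, hPω⟩ := exists_walk_of_mem_openConnIn hω hxy
  have hP : ∀ z ∈ P.support, ∀ j, -(2 * (n : ℤ)) ≤ z j ∧ z j ≤ 2 * (n : ℤ) := fun z hz j => by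
    have h1 := (mem_box.1 (hPS z hz)) j
    push_cast at h1
    exact h1
  rcases hy.2 with hy1 | hy2
  · obtain ⟨e, heP, heω⟩ :=
      exists_edge_not_mem_of_exit 1 (h 1 (by simp)) P hP hx.2.1 hy1
    exact heω (hPω e heP)
  · obtain ⟨e, heP, heω⟩ :=
      exists_edge_not_mem_of_exit 2 (h 2 (by simp)) P hP hx.2.2 hy2
    exact heω (hPω e heP)

/-- **Harris–FKG over the four lateral seals.** Decreasing measurable events `E q`,
`q ∈ {1, 2} × ℤˣ`, of common probability `v`, whose joint occurrence on lattice configurations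
forces an event `C`, give `v ^ 4 ≤ P_p(C)` (`prob_pow_le_biInter_of_isLowerSet`, Grimmett 1999
Thm. 2.4; `real_mono_of_forall_subset_edgeSet`). -/
theorem pow_four_le (p : unitInterval) {E : Fin 3 × ℤˣ → Set (BondConfig (Site 3))} {v : ℝ}
    {C : Set (BondConfig (Site 3))}
    (hE : ∀ q, (bondPercolation (zdGraph 3) p).real (E q) = v) (hL : ∀ q, IsLowerSet (E q))
    (hM : ∀ q, MeasurableSet (E q))
    (hC : ∀ ω, ω ⊆ (zdGraph 3).edgeSet →
      (∀ i ∈ ({1, 2} : Finset (Fin 3)), ∀ ε : ℤˣ, ω ∈ E (i, ε)) → ω ∈ C) :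
    v ^ 4 ≤ (bondPercolation (zdGraph 3) p).real C := by
  have h1 := prob_pow_le_biInter_of_isLowerSet (zdGraph 3) p
    (({1, 2} : Finset (Fin 3)) ×ˢ (Finset.univ : Finset ℤˣ)) E (fun q _ => hL q)
    (fun q _ => hM q) (fun q _ => hE q)
  have h2 : (({1, 2} : Finset (Fin 3)) ×ˢ (Finset.univ : Finset ℤˣ)).card = 4 := by
    rw [Finset.card_product, Finset.card_univ, Fintype.card_units_int]
    rfl
  rw [h2] at h1
  refine h1.trans (real_mono_of_forall_subset_edgeSet (zdGraph 3) p fun ω hω hωE => hC ω hω ?_)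
  intro i hi ε
  exact Set.mem_iInter₂.1 hωE (i, ε) (Finset.mem_product.2 ⟨hi, Finset.mem_univ ε⟩)

/-- **`V_n⁴ ≤ κ_n`** for every `p`, `n`: the four lateral images of the face-slab seal have
probability `V_n` each (`StubSixSlab.real_compl_openCrossing_image`), are decreasing and
measurable, and together make a curtain (`mem_curtain_of_seals`). -/
theorem seal_pow_four_le_curtain (p : unitInterval) (n : ℕ) :
    (bondPercolation (zdGraph 3) p).real
        (openCrossing (Set.Icc (![(n : ℤ), -(2 * (n : ℤ)), -(2 * (n : ℤ))] : Site 3)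
            ![2 * (n : ℤ), 2 * (n : ℤ), 2 * (n : ℤ)])
          {x | x ∈ Set.Icc (![(n : ℤ), -(2 * (n : ℤ)), -(2 * (n : ℤ))] : Site 3)
            ![2 * (n : ℤ), 2 * (n : ℤ), 2 * (n : ℤ)] ∧ x 0 = (n : ℤ)}
          {y | y ∈ Set.Icc (![(n : ℤ), -(2 * (n : ℤ)), -(2 * (n : ℤ))] : Site 3)
            ![2 * (n : ℤ), 2 * (n : ℤ), 2 * (n : ℤ)] ∧ y 0 = 2 * (n : ℤ)})ᶜ ^ 4 ≤
      (bondPercolation (zdGraph 3) p).real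
        (openCrossing (↑(box 3 (2 * n)) : Set (Site 3))
          {v : Site 3 | v ∈ box 3 (2 * n) ∧ |v 1| ≤ (n : ℤ) ∧ |v 2| ≤ (n : ℤ)}
          {v : Site 3 | v ∈ box 3 (2 * n) ∧ (|v 1| = 2 * (n : ℤ) ∨ |v 2| = 2 * (n : ℤ))})ᶜ :=
  pow_four_le p
    (E := fun q : Fin 3 × ℤˣ => (openCrossing
        ((zdSignedPermIso (Equiv.swap (0 : Fin 3) q.1) (fun _ => q.2)) ''
          Set.Icc (![(n : ℤ), -(2 * (n : ℤ)), -(2 * (n : ℤ))] : Site 3)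
            ![2 * (n : ℤ), 2 * (n : ℤ), 2 * (n : ℤ)])
        ((zdSignedPermIso (Equiv.swap (0 : Fin 3) q.1) (fun _ => q.2)) ''
          {x | x ∈ Set.Icc (![(n : ℤ), -(2 * (n : ℤ)), -(2 * (n : ℤ))] : Site 3)
            ![2 * (n : ℤ), 2 * (n : ℤ), 2 * (n : ℤ)] ∧ x 0 = (n : ℤ)})
        ((zdSignedPermIso (Equiv.swap (0 : Fin 3) q.1) (fun _ => q.2)) ''
          {y | y ∈ Set.Icc (![(n : ℤ), -(2 * (n : ℤ)), -(2 * (n : ℤ))] : Site 3)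
            ![2 * (n : ℤ), 2 * (n : ℤ), 2 * (n : ℤ)] ∧ y 0 = 2 * (n : ℤ)}))ᶜ)
    (fun _ => StubSixSlab.real_compl_openCrossing_image _ _ _ _ _)
    (fun _ => (isUpperSet_openCrossing _ _ _).compl)
    (fun _ => (measurableSet_openCrossing_of_countable _ _ _).compl)
    (fun _ hω hE => mem_curtain_of_seals hω fun i hi ε => hE i hi ε)

/-! ### Sub-polynomiality bookkeeping -/

/-- **`⇒` of the stub**: under the crux, `κ_n` is sub-polynomial — the flat seed is
(`stub_cruxIffSeedSubpoly 2`, `⇒`), hence `V_n ≥ seed^K` is (`stub_tiling 2`,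
`StubCruxIffSeedSubpoly.subpoly_of_pow_le`), hence `κ_n ≥ V_n⁴` is (`seal_pow_four_le_curtain`). -/
theorem curtain_subpoly_of_crux
    (h : Summit.CriticalPhenomena.PercolationContinuityZ3.Theses.PercNonProliferation.SubpolynomialBlocking) :
    ∀ s : ℝ, 0 < s → ∀ᶠ n : ℕ in atTop,
      (n : ℝ) ^ (-s) ≤
        (bondPercolation (zdGraph 3) (criticalProbI 3)).real
          (openCrossing (↑(box 3 (2 * n)) : Set (Site 3))
            {v : Site 3 | v ∈ box 3 (2 * n) ∧ |v 1| ≤ (n : ℤ) ∧ |v 2| ≤ (n : ℤ)}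
            {v : Site 3 | v ∈ box 3 (2 * n) ∧ (|v 1| = 2 * (n : ℤ) ∨ |v 2| = 2 * (n : ℤ))})ᶜ := by
  have hseed := (stub_cruxIffSeedSubpoly 2 le_rfl).mp h
  obtain ⟨K, N, hKN⟩ := stub_tiling 2 (by norm_num)
  have hV : ∀ t : ℝ, 0 < t → ∀ᶠ n : ℕ in atTop, (n : ℝ) ^ (-t) ≤
      (bondPercolation (zdGraph 3) (criticalProbI 3)).real
        (openCrossing (Set.Icc (![(n : ℤ), -(2 * (n : ℤ)), -(2 * (n : ℤ))] : Site 3)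
            ![2 * (n : ℤ), 2 * (n : ℤ), 2 * (n : ℤ)])
          {x | x ∈ Set.Icc (![(n : ℤ), -(2 * (n : ℤ)), -(2 * (n : ℤ))] : Site 3)
            ![2 * (n : ℤ), 2 * (n : ℤ), 2 * (n : ℤ)] ∧ x 0 = (n : ℤ)}
          {y | y ∈ Set.Icc (![(n : ℤ), -(2 * (n : ℤ)), -(2 * (n : ℤ))] : Site 3)
            ![2 * (n : ℤ), 2 * (n : ℤ), 2 * (n : ℤ)] ∧ y 0 = 2 * (n : ℤ)})ᶜ := by
    refine StubCruxIffSeedSubpoly.subpoly_of_pow_le (M := K + 1) (by omega) hseed ?_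
    filter_upwards [eventually_ge_atTop N] with n hn
    refine le_trans ?_ (hKN n hn)
    rw [pow_succ]
    exact mul_le_of_le_one_right (pow_nonneg measureReal_nonneg K) measureReal_le_one
  refine StubCruxIffSeedSubpoly.subpoly_of_pow_le (M := 4) (by norm_num) hV ?_
  exact Eventually.of_forall fun n => seal_pow_four_le_curtain (criticalProbI 3) n

/-- **`⇐` of the stub**: a sub-polynomial `κ_n` gives the crux, by `κ_n² ≤ u_n`
(`curtain_sq_le_block`) and `n^{-s} = (n^{-s/2})²` (`StubCruxIffSeedSubpoly.subpoly_of_pow_le`); the crux is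
read through `Negative.SubpolynomialBlockingAt 3 p_c` (`Negative.crux_iff`, definitional). -/
theorem crux_of_curtain_subpoly
    (h : ∀ s : ℝ, 0 < s → ∀ᶠ n : ℕ in atTop,
      (n : ℝ) ^ (-s) ≤
        (bondPercolation (zdGraph 3) (criticalProbI 3)).real
          (openCrossing (↑(box 3 (2 * n)) : Set (Site 3))
            {v : Site 3 | v ∈ box 3 (2 * n) ∧ |v 1| ≤ (n : ℤ) ∧ |v 2| ≤ (n : ℤ)}
            {v : Site 3 | v ∈ box 3 (2 * n) ∧ (|v 1| = 2 * (n : ℤ) ∨ |v 2| = 2 * (n : ℤ))})ᶜ) :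
    SubpolynomialBlockingAt 3 (criticalProbI 3) := by
  refine StubCruxIffSeedSubpoly.subpoly_of_pow_le (M := 2) (by norm_num) h ?_
  exact Eventually.of_forall fun n => curtain_sq_le_block (criticalProbI 3) n

end StubCruxIffCurtainSubpoly

/-- **Registered stub `stub_cruxIffCurtainSubpoly`** (crux stmt-CriticalPhenomena-4446, line
`slab-ladder-two-curtains`): THE CURTAIN FORM OF THE CRUX. The crux `SubpolynomialBlocking`
(`∀ s > 0, ∀ᶠ n, n^{-s} ≤ P_{p_c}(Λ_n ↮ ∂ⁱⁿΛ_{2n} in Λ_{2n})`) holds iff the centred curtain of `ℤ³`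
at `p_c(ℤ³)` — no open path inside `B(2n)` from the column `{v ∈ B(2n) : |v₁| ≤ n, |v₂| ≤ n}` to
its lateral boundary `{v ∈ B(2n) : |v₁| = 2n ∨ |v₂| = 2n}` (Newman–Tassion–Wu 2017, Cor. 3.2 (4),
read on `ℤ³`) — is sub-polynomially likely. `⇐`: two curtains + Harris + the symmetry
`x ↦ (x₂, x₁, x₀)` (`StubCruxIffCurtainSubpoly.curtain_sq_le_block`); `⇒`: four face-slab seals make
a curtain, Harris `V_n⁴ ≤ κ_n` (`StubCruxIffCurtainSubpoly.seal_pow_four_le_curtain`), and `V_n` is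
sub-polynomial under the crux by `stub_cruxIffSeedSubpoly 2` and `stub_tiling 2`.
(Grimmett 1999, Thm. 2.4 and §1.6.) -/
theorem stub_cruxIffCurtainSubpoly :
    Summit.CriticalPhenomena.PercolationContinuityZ3.Theses.PercNonProliferation.SubpolynomialBlocking ↔
      ∀ s : ℝ, 0 < s → ∀ᶠ n : ℕ in atTop, (n : ℝ) ^ (-s) ≤
        (bondPercolation (zdGraph 3) (criticalProbI 3)).real
          {ω | ¬ ∃ x ∈ {v : Site 3 | v ∈ box 3 (2 * n) ∧ |v 1| ≤ (n : ℤ) ∧ |v 2| ≤ (n : ℤ)},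
            ∃ y ∈ {v : Site 3 | v ∈ box 3 (2 * n) ∧ (|v 1| = 2 * (n : ℤ) ∨ |v 2| = 2 * (n : ℤ))},
              ω ∈ openConnIn (↑(box 3 (2 * n)) : Set (Site 3)) x y} := by
  simp only [StubCruxIffCurtainSubpoly.curtain_eq]
  exact ⟨StubCruxIffCurtainSubpoly.curtain_subpoly_of_crux,
    fun h => crux_iff.mpr (StubCruxIffCurtainSubpoly.crux_of_curtain_subpoly h)⟩

end Summit.CriticalPhenomena.PercolationContinuityZ3.Theorems.SubpolynomialBlocking

end
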